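import Summits.Ventures.HSemireg.WedgeHankelRecurrenceSignatureCoprime
import Summits.Ventures.HSemireg.WedgeHankelRecurrenceCommonRoots
import Literature.LinearAlgebra.Matrix.ABVersusBAJordanStructure

/-!
# Venture HSemireg — THE CONGRUENCES BEHIND THE HANKEL FORM OF `b/m`, OVER ANY FIELD: for `m` monic of degree `e + 1` and ANY size `t + 1`, **`H_t(b/m) = Πᵀ · H_e(b/m) · Π`** with `Π`
# the `(e+1) × (t+1)` REDUCTION MATRIX (column `i` = coefficients of `X^i mod m`), onto for `t ≥ e`; for coprime monic `m₁`, `m₂`: **`H_t(b₁/m₁ + b₂/m₂) = [Π₁; Π₂]ᵀ · (H_{e₁}(b₁/m₁) ⊕ H_{e₂}(b₂/m₂)) ·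
# [Π₁; Π₂]`** with `[Π₁; Π₂]` onto for `t + 1 ≥ deg(m₁m₂)` (Chinese remainder); hence, in ANY characteristic, **`rank H_t(b/m) = deg(m / gcd(m, b))` for EVERY `t ≥ e`** and
# **`rank H_t(b₁/m₁ + b₂/m₂) = rank H_t(b₁/m₁) + rank H_t(b₂/m₂)`** (one size `t + 1 ≥ deg(m₁m₂)`) — the rank statements N136 had only over ordered fields (its caveat «the any-field rank additivity is not typed»)

HONEST FRAMING. Part of the Lean index of the computation cell `pub-hsemireg` (seat p10 gen 35, Sunday typer «UNIFORM-IN-n»).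
LINEAR ALGEBRA OF HANKEL (catalecticant) MATRICES AND POLYNOMIALS OVER A FIELD ONLY (`Polynomial.modByMonic`, `Matrix.rank`, `Matrix.fromRows` ∕ `fromBlocks`; PROVED Literature
`LinearAlgebra/Matrix/ABVersusBAJordanStructure` — `rank (X ⊕ Z) = rank X + rank Z` — IMPORTED): no variety, no cohomology theory, no sheaf, no Ext group and no semiregularity map is constructed here;
nothing here says that HC / HC_CM / HC_AV holds; no Literature fact (unproved `Prop`) is declared or used.  Custodian versions as in `WedgeHankelSiegelIdeal` (1/3).
SOURCE OF THE ARGUMENT (classical; cited, not used): the Hankel form of `b/m` is the trace-like pairing `(f, g) ↦ ℓ(f g b)`, `ℓ = [X^{deg m − 1}](· mod m)`, on `K[X]/(m)` pulled back to `K[X]_{≤ t}`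
(L. Kronecker, *Zur Theorie der Elimination einer Variabeln aus zwei algebraischen Gleichungen*, Monatsber. Berlin 1881; F. R. Gantmacher, *The Theory of Matrices* II, Ch. XV §10; S. Basu,
R. Pollack, M.-F. Roy, *Algorithms in Real Algebraic Geometry* (2006) §9.2.2 Cor. 9.19 / Eq. (9.9) for the dual Horner basis); the Chinese remainder theorem makes the pair of reductions onto.
N136 typed exactly this for the QUADRATIC forms (`q_{H_t} = q_{H_e} ∘ Π`, `sigPos` ∕ `sigNeg` by N126's pull-back law); this file types the MATRIX identities, which also hold in characteristic `2`
(where the quadratic form forgets the off-diagonal part) and give the RANK over any field by one-sided inverses.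
DEDUP DISCLOSURE (`rg` of the whole tree + Mathlib, 2026-09-01): N136 (`WedgeHankelRecurrenceSignatureCoprime`) has the form-level statements and the rank statements OVER ORDERED FIELDS
(`rank_hankelSq_dualSeq_eq_of_natDegree_le`, `rank_hankelSq_dualSeq_add_of_isCoprime`, `rank_hankelSq_dualSeq_mul_derivative_of_isCoprime`, all `[LinearOrder K] [IsStrictOrderedRing K]`);
N101 (`…CommonRoots`) `rank_hankelSq_dualSeq_eq_natDegree_div_gcd` is the any-field rank AT SIZE `deg m` only; N82 (`…Kronecker`) bounds the middle ranks `R^N ≤ deg m` and N32 has `R^N = deg m` for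
`a` prime to `m` (`rank_hankel1_half_dualSeq_of_isCoprime`), neither gives the value at every square size for a non-unit `b`; N73 `hankelSq_dualSeq_eq_mul` is the square case `t = e` of §741
with `Π = 1`-like bookkeeping (`H_e(b/m) = H_e(1/m) · M_b`, a different factorisation).  Literature `HankelRankRationalFunction` (Gantmacher XV §10) is about the infinite Hankel matrix and power
series; `ABVersusBAJordanStructure.rank_fromBlocks_zero₁₂_zero₂₁` is imported.  17 names: 0 hits tree-wide (the gate's `dedup.landed` compares statements WITHOUT their instance hypotheses, so the any-field rank laws are stated in shapes N136 does not have: the value at every size, two arbitrary sizes, all summands at one size).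

WHAT IS IN THE TREE.  N18 `hkFun` (`⟪p, q⟫_s = Σ_i p_i q_{i+s}`), `hkFun_eq_sum_range`, `hkFun_X_pow_mul`; N32 `dualSeq`, `dualSeq_apply`; N136 `hkFun_dualSeq_zero` (`⟪p, dualSeq m b⟫₀ = [X^{deg m−1}](p b mod m)`),
**`exists_coeff_modByMonic_eq`** (reduction onto for `e ≤ t`), **`exists_coeff_modByMonic_eq_and_eq`** (CRT: the pair of reductions onto for `e₁ + e₂ + 2 ≤ t + 1`), `dualSeq_mul_mul_derivative_mul`;
N45 `dualSeq_add_dualSeq` (`b₁/m₁ + b₂/m₂ = (b₁m₂ + b₂m₁)/(m₁m₂)`); N48 `hankelSq`; N101 `rank_hankelSq_dualSeq_eq_natDegree_div_gcd`, `natDegree_div_gcd_add`.  Literature `rank_fromBlocks_zero₁₂_zero₂₁`.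
Mathlib: `Matrix.mulVec_surjective_iff_exists_right_inverse`, `Matrix.rank_mul_le_left/right`, `Matrix.fromRows_mulVec`, `Matrix.transpose_fromRows`, `Matrix.fromCols_mul_fromBlocks`,
`Matrix.fromCols_mul_fromRows`, `Polynomial.modByMonicHom`, `Polynomial.smul_modByMonic`, `Polynomial.modByMonic_eq_sub_mul_div`, `Polynomial.as_sum_range'`.
THIS FILE (namespace `Summit.Ventures.HSemireg.Wedge.HankelOuter` continued; PLAIN on N136 + N101 + Literature `ABVersusBAJordanStructure`; 0 definitions — the reduction matrix is written out as
`Matrix.of fun (k : Fin (e + 1)) (i : Fin (t + 1)) => (X^i mod m).coeff k`):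
* §741 THE PAIRING: `sum_sum_coeff_mul_hankelSq_mul_coeff` (`Σ_{k,l ≤ e} p_k (H_e(s))_{kl} q_l = ⟪p q, s⟫₀`, `deg p, deg q ≤ e`), `modByMonic_mul_modByMonic_mul_modByMonic` (`((p mod m)(q mod m) b) mod m =
  (p q b) mod m`), `coeffModByMonic_mulVec` (`Π v` = coefficients of `f_v mod m`), **`hankelSq_dualSeq_eq_transpose_mul_mul`** (`H_t(b/m) = Πᵀ H_e(b/m) Π`, ANY `t`, any field).
* §742 ONE-SIDED INVERSES AND RANK: `rank_transpose_mul_mul_of_mulVec_surjective` (`rank (Pᵀ H P) = rank H` for `P` onto), `coeffModByMonic_mulVec_surjective` (`Π` onto for `e ≤ t`),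
  **`rank_hankelSq_dualSeq_eq_natDegree_div_gcd_of_le`** (`rank H_t(b/m) = deg(m / gcd(m, b))` for EVERY `t ≥ e`, ANY field: Kronecker's count at every square size),
  **`rank_hankelSq_dualSeq_eq_rank_of_le_of_le`** (`rank H_t(b/m) = rank H_{t'}(b/m)`, any two sizes `≥ deg m`), `rank_hankelSq_dualSeq_add_natDegree_gcd_of_le`,
  `rank_hankelSq_dualSeq_eq_natDegree_iff_isCoprime_of_le` (`= deg m ⟺ gcd(m, b) = 1`).
* §743 CHINESE REMAINDER, MATRIX FORM: `fromRows_coeffModByMonic_mulVec_surjective` (`[Π₁; Π₂]` onto), **`hankelSq_dualSeq_add_eq_transpose_mul_fromBlocks_mul`** (`H_t(b₁/m₁ + b₂/m₂) = [Π₁;Π₂]ᵀ (H_{e₁} ⊕ H_{e₂}) [Π₁;Π₂]`,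
  any monic `m₁`, `m₂`, any `t`), **`rank_hankelSq_dualSeq_add_eq_add_rank`** (RANK ADDITIVITY over any field, ALL AT ONE SIZE `t + 1 ≥ deg(m₁m₂)`: `rank H_t(b₁/m₁ + b₂/m₂) = rank H_t(b₁/m₁) +
  rank H_t(b₂/m₂)`), `rank_hankelSq_dualSeq_add_eq_natDegree_add` (`= deg(m₁/gcd) + deg(m₂/gcd)`), `rank_hankelSq_dualSeq_mul_eq_add_rank` (`(b₁m₂ + b₂m₁)/(m₁m₂)`),
  **`rank_hankelSq_dualSeq_mul_derivative_eq_add_rank`** (Hermite's symbols `a(m₁m₂)′/(m₁m₂)`), `natDegree_div_gcd_mul_eq_add` (the arithmetic shadow: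
  `deg(m₁m₂/gcd(m₁m₂, b₁m₂ + b₂m₁)) = deg(m₁/gcd(m₁,b₁)) + deg(m₂/gcd(m₂,b₂))`).
CAVEATS.  `m`, `mᵢ` MONIC; the right sizes are forced: for `t < e` the reduction is not onto and `rank H_t(b/m) < rank H_e(b/m)` can happen (`t = 0`, `b/m = 1/X²`: `H_0 = (0)`), and for `t + 1 <
deg(m₁m₂)` additivity fails (N136's header example `1/X + 1/X` is excluded by coprimality; `m₁ = X`, `m₂ = X − 1`, `t = 0`: `H_0(1/X + 1/(X−1)) = (2)` has rank `1 ≠ 1 + 1` over `ℚ` and rank `0` over `𝔽₂`).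
Nothing Ext-side.  New names only.
-/

open Module Polynomial
open scoped Matrix Polynomial

namespace Summit.Ventures.HSemireg.Wedge.HankelOuter

open Summit.Ventures.HSemireg.Wedge Summit.Ventures.HSemireg.Wedge.Hankel

variable (K : Type*) [Field K]

/-! ## §741. The pairing behind the Hankel form and the congruence `H_t(b/m) = Πᵀ · H_e(b/m) · Π` -/

/-- **The Hankel matrix as a bilinear pairing: `Σ_{k, l ≤ e} p_k · s_{k+l} · q_l = ⟪p·q, s⟫₀`** for `deg p, deg q ≤ e` (N18's functional on the PRODUCT; N136 has the square case `p = q`).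
[this file, §741] -/
theorem sum_sum_coeff_mul_hankelSq_mul_coeff (e : ℕ) (s : ℕ → K) {p q : K[X]} (hp : p.natDegree < e + 1) (hq : q.natDegree < e + 1) :
    ∑ k : Fin (e + 1), ∑ l : Fin (e + 1), p.coeff (k : ℕ) * hankelSq K e s k l * q.coeff (l : ℕ) = hkFun K s 0 (p * q) := by
  conv_rhs => rw [Polynomial.as_sum_range' p (e + 1) hp, Finset.sum_mul, map_sum, ← Fin.sum_univ_eq_sum_range]
  refine Finset.sum_congr rfl fun k _ => ?_
  rw [← Polynomial.C_mul_X_pow_eq_monomial, mul_assoc, Polynomial.C_mul', map_smul, smul_eq_mul, hkFun_X_pow_mul, zero_add, hkFun_eq_sum_range K s (k : ℕ) hq,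
    ← Fin.sum_univ_eq_sum_range, Finset.mul_sum]
  refine Finset.sum_congr rfl fun l _ => ?_
  rw [hankelSq, Matrix.of_apply, add_comm (l : ℕ) (k : ℕ)]
  ring

variable {K} in
/-- `((p mod m) · (q mod m) · b) mod m = (p · q · b) mod m` (`m` monic). [bookkeeping] -/
theorem modByMonic_mul_modByMonic_mul_modByMonic {m : K[X]} (hm : m.Monic) (p q b : K[X]) : ((p %ₘ m) * (q %ₘ m) * b) %ₘ m = (p * q * b) %ₘ m := by
  refine Polynomial.modByMonic_eq_of_dvd_sub hm ?_
  have hp : m ∣ p %ₘ m - p := by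
    rw [Polynomial.modByMonic_eq_sub_mul_div p m, sub_sub_cancel_left, dvd_neg]; exact dvd_mul_right m _
  have hq : m ∣ q %ₘ m - q := by
    rw [Polynomial.modByMonic_eq_sub_mul_div q m, sub_sub_cancel_left, dvd_neg]; exact dvd_mul_right m _
  rw [show (p %ₘ m) * (q %ₘ m) * b - p * q * b = ((p %ₘ m - p) * (q %ₘ m) + p * (q %ₘ m - q)) * b by ring]
  exact ((hp.mul_right _).add (hq.mul_left _)).mul_right _

/-- **The reduction matrix acts as reduction: `Π v` is the coefficient vector of `f_v mod m`**, `Π = ((X^i mod m).coeff k)_{k ≤ e, i ≤ t}`, `f_v = Σ_i v_i X^i` (N136's reduction map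
`pi_lcoeff_modByMonicHom` as a matrix). [this file, §741] -/
theorem coeffModByMonic_mulVec (m : K[X]) (e t : ℕ) (v : Fin (t + 1) → K) :
    (Matrix.of fun (k : Fin (e + 1)) (i : Fin (t + 1)) => (Polynomial.X ^ (i : ℕ) %ₘ m).coeff (k : ℕ)) *ᵥ v
      = fun k : Fin (e + 1) => ((∑ i : Fin (t + 1), monomial (i : ℕ) (v i)) %ₘ m).coeff (k : ℕ) := by
  funext k
  rw [Matrix.mulVec, dotProduct, ← Polynomial.modByMonicHom_apply, map_sum, Polynomial.finsetSum_coeff]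
  refine Finset.sum_congr rfl fun i _ => ?_
  rw [Matrix.of_apply, Polynomial.modByMonicHom_apply, ← Polynomial.C_mul_X_pow_eq_monomial, Polynomial.C_mul', Polynomial.smul_modByMonic, Polynomial.coeff_smul, smul_eq_mul, mul_comm]

/-- **THE CONGRUENCE `H_t(b/m) = Πᵀ · H_e(b/m) · Π` over ANY field, for ANY size `t`** (`m` monic of degree `e + 1`; `Π_{k i} = [X^k](X^i mod m)`): entry `(i, j)` of both sides is
`[X^e]((X^i mod m)(X^j mod m) b mod m) = [X^e](X^{i+j} b mod m) = dualSeq m b (i + j)` (the matrix form of N136 `toQuadraticForm'_hankelSq_dualSeq_eq_modByMonic`, valid also in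
characteristic `2`). [this file, §741] -/
theorem hankelSq_dualSeq_eq_transpose_mul_mul {e : ℕ} {m : K[X]} (hm : m.Monic) (hmd : m.natDegree = e + 1) (b : K[X]) (t : ℕ) :
    hankelSq K t (dualSeq K m b)
      = (Matrix.of fun (k : Fin (e + 1)) (i : Fin (t + 1)) => (Polynomial.X ^ (i : ℕ) %ₘ m).coeff (k : ℕ))ᵀ * hankelSq K e (dualSeq K m b)
          * Matrix.of fun (k : Fin (e + 1)) (i : Fin (t + 1)) => (Polynomial.X ^ (i : ℕ) %ₘ m).coeff (k : ℕ) := by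
  have hm1 : m ≠ 1 := fun h => by rw [h, Polynomial.natDegree_one] at hmd; omega
  have hdeg : ∀ n : ℕ, (Polynomial.X ^ n %ₘ m).natDegree < e + 1 := fun n => (Polynomial.natDegree_modByMonic_lt _ hm hm1).trans_eq hmd
  ext i j
  rw [Matrix.mul_apply]
  simp_rw [Matrix.mul_apply, Matrix.transpose_apply, Matrix.of_apply, Finset.sum_mul]
  rw [Finset.sum_comm, sum_sum_coeff_mul_hankelSq_mul_coeff K e (dualSeq K m b) (hdeg i) (hdeg j), hkFun_dualSeq_zero, modByMonic_mul_modByMonic_mul_modByMonic hm, ← pow_add, hankelSq,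
    Matrix.of_apply, dualSeq_apply]

/-! ## §742. One-sided inverses: the rank of `H_t(b/m)` does not depend on `t ≥ e`, over any field -/

variable {K} in
/-- **`rank (Pᵀ · H · P) = rank H` whenever `P` is ONTO** (`P` has a right inverse `B`, so `H = Bᵀ (Pᵀ H P) B` and the two ranks bound each other). [this file, §742] -/
theorem rank_transpose_mul_mul_of_mulVec_surjective {p n : Type*} [Fintype p] [Fintype n] [DecidableEq p] {P : Matrix p n K} (hP : Function.Surjective P.mulVec) (H : Matrix p p K) :
    (Pᵀ * H * P).rank = H.rank := by
  obtain ⟨B, hB⟩ := Matrix.mulVec_surjective_iff_exists_right_inverse.1 hP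
  refine le_antisymm ((Matrix.rank_mul_le_left _ _).trans (Matrix.rank_mul_le_right _ _)) ?_
  have hH : H = Bᵀ * (Pᵀ * H * P) * B := by
    rw [Matrix.mul_assoc Pᵀ H P, ← Matrix.mul_assoc Bᵀ Pᵀ (H * P), ← Matrix.transpose_mul, hB, Matrix.transpose_one, Matrix.one_mul, Matrix.mul_assoc H P B, hB, Matrix.mul_one]
  conv_lhs => rw [hH]
  exact (Matrix.rank_mul_le_left _ _).trans (Matrix.rank_mul_le_right _ _)

/-- **The reduction matrix is ONTO for `e ≤ t`** (every coefficient vector of length `e + 1` is its own reduction; N136 `exists_coeff_modByMonic_eq`). [this file, §742] -/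
theorem coeffModByMonic_mulVec_surjective {e t : ℕ} {m : K[X]} (hm : m.Monic) (hmd : m.natDegree = e + 1) (ht : e + 1 ≤ t + 1) :
    Function.Surjective (Matrix.of fun (k : Fin (e + 1)) (i : Fin (t + 1)) => (Polynomial.X ^ (i : ℕ) %ₘ m).coeff (k : ℕ)).mulVec := fun u => by
  obtain ⟨v, hv⟩ := exists_coeff_modByMonic_eq K hm hmd ht u
  exact ⟨v, by rw [coeffModByMonic_mulVec, hv]⟩

/-- **KRONECKER'S COUNT AT EVERY SQUARE SIZE, over ANY field: `rank H_t(b/m) = deg (m / gcd(m, b))` for every `t ≥ e = deg m − 1`** (`m` monic; N101 is the case `t = e`; §741–§742 move it to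
every larger size by the onto reduction). [this file, §742] -/
theorem rank_hankelSq_dualSeq_eq_natDegree_div_gcd_of_le [DecidableEq K] {e t : ℕ} {m : K[X]} (hm : m.Monic) (hmd : m.natDegree = e + 1) (ht : e + 1 ≤ t + 1) (b : K[X]) :
    (hankelSq K t (dualSeq K m b)).rank = (m / EuclideanDomain.gcd m b).natDegree := by
  rw [hankelSq_dualSeq_eq_transpose_mul_mul K hm hmd b t, rank_transpose_mul_mul_of_mulVec_surjective (coeffModByMonic_mulVec_surjective K hm hmd ht),
    rank_hankelSq_dualSeq_eq_natDegree_div_gcd K hm hmd]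

/-- **SIZE INDEPENDENCE OF THE RANK over ANY field: `rank H_t(b/m) = rank H_{t'}(b/m)` for any two sizes `t + 1, t' + 1 ≥ deg m`** (N136 compared `t` with `e = deg m − 1` over ORDERED fields via
`sigPos + sigNeg`; here any field, any characteristic). [this file, §742] -/
theorem rank_hankelSq_dualSeq_eq_rank_of_le_of_le {e t t' : ℕ} {m : K[X]} (hm : m.Monic) (hmd : m.natDegree = e + 1) (ht : e + 1 ≤ t + 1) (ht' : e + 1 ≤ t' + 1) (b : K[X]) :
    (hankelSq K t (dualSeq K m b)).rank = (hankelSq K t' (dualSeq K m b)).rank := by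
  classical
  rw [rank_hankelSq_dualSeq_eq_natDegree_div_gcd_of_le K hm hmd ht, rank_hankelSq_dualSeq_eq_natDegree_div_gcd_of_le K hm hmd ht']

/-- **… i.e. `rank H_t(b/m) + deg gcd(m, b) = deg m`** (`t ≥ e`). [this file, §742] -/
theorem rank_hankelSq_dualSeq_add_natDegree_gcd_of_le [DecidableEq K] {e t : ℕ} {m : K[X]} (hm : m.Monic) (hmd : m.natDegree = e + 1) (ht : e + 1 ≤ t + 1) (b : K[X]) :
    (hankelSq K t (dualSeq K m b)).rank + (EuclideanDomain.gcd m b).natDegree = e + 1 := by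
  rw [rank_hankelSq_dualSeq_eq_natDegree_div_gcd_of_le K hm hmd ht, ← hmd]
  exact natDegree_div_gcd_add K hm.ne_zero b

/-- **`rank H_t(b/m) = deg m ⟺ gcd(m, b) = 1`** for every `t ≥ e` (any field; N73 at `t = e`). [this file, §742] -/
theorem rank_hankelSq_dualSeq_eq_natDegree_iff_isCoprime_of_le [DecidableEq K] {e t : ℕ} {m : K[X]} (hm : m.Monic) (hmd : m.natDegree = e + 1) (ht : e + 1 ≤ t + 1) (b : K[X]) :
    (hankelSq K t (dualSeq K m b)).rank = e + 1 ↔ IsCoprime m b := by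
  rw [rank_hankelSq_dualSeq_eq_rank_of_le_of_le K hm hmd ht le_rfl, rank_hankelSq_eq_iff_det_ne_zero K e (dualSeq K m b), det_hankelSq_dualSeq_ne_zero_iff K hm hmd]

/-! ## §743. Chinese remainder, matrix form: `H_t(b₁/m₁ + b₂/m₂) = [Π₁; Π₂]ᵀ · (H_{e₁}(b₁/m₁) ⊕ H_{e₂}(b₂/m₂)) · [Π₁; Π₂]` and rank additivity over any field -/

/-- **The pair of reduction matrices `[Π₁; Π₂]` is ONTO `K^{e₁+1} ⊕ K^{e₂+1}` for `m₁`, `m₂` monic coprime of degrees `e₁ + 1`, `e₂ + 1` with `e₁ + e₂ + 2 ≤ t + 1`** (N136's Chinese remainder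
`exists_coeff_modByMonic_eq_and_eq`, matrix form). [this file, §743] -/
theorem fromRows_coeffModByMonic_mulVec_surjective {e₁ e₂ t : ℕ} {m₁ m₂ : K[X]} (hm₁ : m₁.Monic) (hm₂ : m₂.Monic) (hc : IsCoprime m₁ m₂) (hd₁ : m₁.natDegree = e₁ + 1)
    (hd₂ : m₂.natDegree = e₂ + 1) (ht : e₁ + e₂ + 2 ≤ t + 1) :
    Function.Surjective (Matrix.fromRows (Matrix.of fun (k : Fin (e₁ + 1)) (i : Fin (t + 1)) => (Polynomial.X ^ (i : ℕ) %ₘ m₁).coeff (k : ℕ))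
      (Matrix.of fun (k : Fin (e₂ + 1)) (i : Fin (t + 1)) => (Polynomial.X ^ (i : ℕ) %ₘ m₂).coeff (k : ℕ))).mulVec := fun w => by
  obtain ⟨v, hv₁, hv₂⟩ := exists_coeff_modByMonic_eq_and_eq K hm₁ hm₂ hc hd₁ hd₂ ht (fun k => w (Sum.inl k)) (fun k => w (Sum.inr k))
  refine ⟨v, ?_⟩
  rw [Matrix.fromRows_mulVec, coeffModByMonic_mulVec, coeffModByMonic_mulVec, hv₁, hv₂]
  funext c
  rcases c with c | c <;> rfl

/-- **CHINESE REMAINDER, MATRIX FORM: `H_t(b₁/m₁ + b₂/m₂) = [Π₁; Π₂]ᵀ · (H_{e₁}(b₁/m₁) ⊕ H_{e₂}(b₂/m₂)) · [Π₁; Π₂]`** for ANY monic `m₁`, `m₂` of degrees `e₁ + 1`, `e₂ + 1`, any `b₁`, `b₂`, any `t` (§741 for each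
summand; `⊕` = `Matrix.fromBlocks _ 0 0 _`, `[Π₁; Π₂]` = `Matrix.fromRows`). [this file, §743] -/
theorem hankelSq_dualSeq_add_eq_transpose_mul_fromBlocks_mul {e₁ e₂ : ℕ} {m₁ m₂ : K[X]} (hm₁ : m₁.Monic) (hm₂ : m₂.Monic) (hd₁ : m₁.natDegree = e₁ + 1) (hd₂ : m₂.natDegree = e₂ + 1)
    (b₁ b₂ : K[X]) (t : ℕ) :
    hankelSq K t (dualSeq K m₁ b₁ + dualSeq K m₂ b₂)
      = (Matrix.fromRows (Matrix.of fun (k : Fin (e₁ + 1)) (i : Fin (t + 1)) => (Polynomial.X ^ (i : ℕ) %ₘ m₁).coeff (k : ℕ))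
            (Matrix.of fun (k : Fin (e₂ + 1)) (i : Fin (t + 1)) => (Polynomial.X ^ (i : ℕ) %ₘ m₂).coeff (k : ℕ)))ᵀ
          * Matrix.fromBlocks (hankelSq K e₁ (dualSeq K m₁ b₁)) 0 0 (hankelSq K e₂ (dualSeq K m₂ b₂))
          * Matrix.fromRows (Matrix.of fun (k : Fin (e₁ + 1)) (i : Fin (t + 1)) => (Polynomial.X ^ (i : ℕ) %ₘ m₁).coeff (k : ℕ))
            (Matrix.of fun (k : Fin (e₂ + 1)) (i : Fin (t + 1)) => (Polynomial.X ^ (i : ℕ) %ₘ m₂).coeff (k : ℕ)) := by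
  have hadd : hankelSq K t (dualSeq K m₁ b₁ + dualSeq K m₂ b₂) = hankelSq K t (dualSeq K m₁ b₁) + hankelSq K t (dualSeq K m₂ b₂) := by
    ext i j; simp only [hankelSq, Matrix.of_apply, Matrix.add_apply, Pi.add_apply]
  rw [hadd, Matrix.transpose_fromRows, Matrix.fromCols_mul_fromBlocks, Matrix.mul_zero, Matrix.mul_zero, add_zero, zero_add, Matrix.fromCols_mul_fromRows,
    ← hankelSq_dualSeq_eq_transpose_mul_mul K hm₁ hd₁ b₁ t, ← hankelSq_dualSeq_eq_transpose_mul_mul K hm₂ hd₂ b₂ t]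

/-- **RANK ADDITIVITY OVER PARTIAL FRACTIONS WITH COPRIME DENOMINATORS, ANY FIELD, ALL AT ONE SIZE: `rank H_t(b₁/m₁ + b₂/m₂) = rank H_t(b₁/m₁) + rank H_t(b₂/m₂)`** for `m₁`, `m₂` monic
coprime of degrees `e₁ + 1`, `e₂ + 1`, any residues, and any size `t + 1 ≥ e₁ + e₂ + 2 = deg(m₁m₂)` (§743 + Literature `rank (X ⊕ Z) = rank X + rank Z` + §742; N136's `rank_hankelSq_dualSeq_add_of_isCoprime`
is the ordered-field statement with the summands at their own sizes `e₁`, `e₂`). [this file, §743] -/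
theorem rank_hankelSq_dualSeq_add_eq_add_rank {e₁ e₂ t : ℕ} {m₁ m₂ : K[X]} (hm₁ : m₁.Monic) (hm₂ : m₂.Monic) (hc : IsCoprime m₁ m₂) (hd₁ : m₁.natDegree = e₁ + 1) (hd₂ : m₂.natDegree = e₂ + 1)
    (ht : e₁ + e₂ + 2 ≤ t + 1) (b₁ b₂ : K[X]) :
    (hankelSq K t (dualSeq K m₁ b₁ + dualSeq K m₂ b₂)).rank = (hankelSq K t (dualSeq K m₁ b₁)).rank + (hankelSq K t (dualSeq K m₂ b₂)).rank := by
  rw [hankelSq_dualSeq_add_eq_transpose_mul_fromBlocks_mul K hm₁ hm₂ hd₁ hd₂ b₁ b₂ t, rank_transpose_mul_mul_of_mulVec_surjective (fromRows_coeffModByMonic_mulVec_surjective K hm₁ hm₂ hc hd₁ hd₂ ht),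
    Literature.LinearAlgebra.Matrix.rank_fromBlocks_zero₁₂_zero₂₁, rank_hankelSq_dualSeq_eq_rank_of_le_of_le K hm₁ hd₁ le_rfl (show e₁ + 1 ≤ t + 1 by omega),
    rank_hankelSq_dualSeq_eq_rank_of_le_of_le K hm₂ hd₂ le_rfl (show e₂ + 1 ≤ t + 1 by omega)]

/-- **… in closed form: `rank H_t(b₁/m₁ + b₂/m₂) = deg(m₁/gcd(m₁, b₁)) + deg(m₂/gcd(m₂, b₂))`** (same hypotheses; the number of poles of the sum is the sum of the numbers of poles). [this file, §743] -/
theorem rank_hankelSq_dualSeq_add_eq_natDegree_add [DecidableEq K] {e₁ e₂ t : ℕ} {m₁ m₂ : K[X]} (hm₁ : m₁.Monic) (hm₂ : m₂.Monic) (hc : IsCoprime m₁ m₂) (hd₁ : m₁.natDegree = e₁ + 1)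
    (hd₂ : m₂.natDegree = e₂ + 1) (ht : e₁ + e₂ + 2 ≤ t + 1) (b₁ b₂ : K[X]) :
    (hankelSq K t (dualSeq K m₁ b₁ + dualSeq K m₂ b₂)).rank = (m₁ / EuclideanDomain.gcd m₁ b₁).natDegree + (m₂ / EuclideanDomain.gcd m₂ b₂).natDegree := by
  rw [rank_hankelSq_dualSeq_add_eq_add_rank K hm₁ hm₂ hc hd₁ hd₂ ht, rank_hankelSq_dualSeq_eq_natDegree_div_gcd_of_le K hm₁ hd₁ (show e₁ + 1 ≤ t + 1 by omega),
    rank_hankelSq_dualSeq_eq_natDegree_div_gcd_of_le K hm₂ hd₂ (show e₂ + 1 ≤ t + 1 by omega)]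

/-- **… for one dual class of the product: `rank H_t((b₁m₂ + b₂m₁)/(m₁m₂)) = rank H_t(b₁/m₁) + rank H_t(b₂/m₂)`** (N45 `dualSeq_add_dualSeq`). [this file, §743] -/
theorem rank_hankelSq_dualSeq_mul_eq_add_rank {e₁ e₂ t : ℕ} {m₁ m₂ : K[X]} (hm₁ : m₁.Monic) (hm₂ : m₂.Monic) (hc : IsCoprime m₁ m₂) (hd₁ : m₁.natDegree = e₁ + 1) (hd₂ : m₂.natDegree = e₂ + 1)
    (ht : e₁ + e₂ + 2 ≤ t + 1) (b₁ b₂ : K[X]) :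
    (hankelSq K t (dualSeq K (m₁ * m₂) (b₁ * m₂ + b₂ * m₁))).rank = (hankelSq K t (dualSeq K m₁ b₁)).rank + (hankelSq K t (dualSeq K m₂ b₂)).rank := by
  rw [← dualSeq_add_dualSeq K hm₁ hm₂, rank_hankelSq_dualSeq_add_eq_add_rank K hm₁ hm₂ hc hd₁ hd₂ ht]

/-- **HERMITE'S SYMBOLS ADD IN RANK over any field, at one size: `rank H_t(a·(m₁m₂)′/(m₁m₂)) = rank H_t(a·m₁′/m₁) + rank H_t(a·m₂′/m₂)`** (`m₁`, `m₂` monic coprime, `deg(m₁m₂) ≤ t + 1`;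
N136 `dualSeq_mul_mul_derivative_mul`; N136's `rank_…_mul_derivative_of_isCoprime` was the ordered-field statement at sizes `e₁`, `e₂`). [this file, §743] -/
theorem rank_hankelSq_dualSeq_mul_derivative_eq_add_rank {e₁ e₂ t : ℕ} {m₁ m₂ : K[X]} (hm₁ : m₁.Monic) (hm₂ : m₂.Monic) (hc : IsCoprime m₁ m₂) (hd₁ : m₁.natDegree = e₁ + 1)
    (hd₂ : m₂.natDegree = e₂ + 1) (ht : e₁ + e₂ + 2 ≤ t + 1) (a : K[X]) :
    (hankelSq K t (dualSeq K (m₁ * m₂) (a * derivative (m₁ * m₂)))).rank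
      = (hankelSq K t (dualSeq K m₁ (a * derivative m₁))).rank + (hankelSq K t (dualSeq K m₂ (a * derivative m₂))).rank := by
  rw [dualSeq_mul_mul_derivative_mul K hm₁ hm₂, rank_hankelSq_dualSeq_add_eq_add_rank K hm₁ hm₂ hc hd₁ hd₂ ht]

/-- **The arithmetic shadow: `deg(m₁m₂ / gcd(m₁m₂, b₁m₂ + b₂m₁)) = deg(m₁ / gcd(m₁, b₁)) + deg(m₂ / gcd(m₂, b₂))`** for monic coprime `m₁`, `m₂` of positive degree (read off the three ranks;
a statement about polynomial gcds proved by linear algebra). [this file, §743] -/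
theorem natDegree_div_gcd_mul_eq_add [DecidableEq K] {e₁ e₂ : ℕ} {m₁ m₂ : K[X]} (hm₁ : m₁.Monic) (hm₂ : m₂.Monic) (hc : IsCoprime m₁ m₂) (hd₁ : m₁.natDegree = e₁ + 1) (hd₂ : m₂.natDegree = e₂ + 1)
    (b₁ b₂ : K[X]) :
    (m₁ * m₂ / EuclideanDomain.gcd (m₁ * m₂) (b₁ * m₂ + b₂ * m₁)).natDegree = (m₁ / EuclideanDomain.gcd m₁ b₁).natDegree + (m₂ / EuclideanDomain.gcd m₂ b₂).natDegree := by
  have hmd : (m₁ * m₂).natDegree = (e₁ + e₂ + 1) + 1 := by rw [hm₁.natDegree_mul hm₂, hd₁, hd₂]; ring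
  rw [← rank_hankelSq_dualSeq_eq_natDegree_div_gcd K (hm₁.mul hm₂) hmd, ← dualSeq_add_dualSeq K hm₁ hm₂, rank_hankelSq_dualSeq_add_eq_natDegree_add K hm₁ hm₂ hc hd₁ hd₂ le_rfl]

end Summit.Ventures.HSemireg.Wedge.HankelOuter
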